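import Literature.Barriers.CriticalPhenomena.LaceExpansionXSpaceTriangleNumerics
import HarnessLib

/-!
# Liu–Slade (2026), §7.2: the numerical input of the subcritical-to-critical crossover theorem
# for nearest-neighbour percolation — `Δ⁽⁰⁾(p_c) ≤ 0.43`, `Δ̃⁽⁰⁾(p_c) ≤ 0.18` ("`d₀ = 15` is
# sufficient") — and the closing inequality of its bootstrap, in the tree's triangle vocabulary

CITATION HEADER. Source: Y. Liu, G. Slade, *Crossover from subcritical to critical decay: random
walk, self-avoiding walk, percolation*, arXiv:2605.15545v1 (15 May 2026), UNREFEREED (bib key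
`LiuSlade2026Crossover`; held as `lit paper:arxiv-2605.15545`, TeX source `corpus-tex` — the store
holds no PDF, so locators below are section / lemma numbers and the authors' LaTeX labels, not PDF
pages). Companion of `Literature/Barriers/CriticalPhenomena/LaceExpansionXSpaceTriangleNumerics.lean`,
whose named fact `FitznerVanDerHofstad2017_triangleBoundsPc` is the `d = 11` input this file
evaluates against. Origin: build `lace`, unit `b2b-lace-dmps-g18` (the "DMPS route" seat, whose
brief is the census of non-NoBLE doors and consumers for nearest-neighbour `ℤ^d`, `d = 10, 11`).

WHAT THE PAPER PROVES, AND FOR WHICH `d`. Theorem 7.1 (§7.1): "(i) The function `τ_p` obeys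
Assumption Ω for all `d ≥ 2` and `p ∈ (0, p_c)`. (ii) For nearest-neighbour percolation in
dimensions `d ≥ 15`, and for any fixed `ζ ∈ (0, ½(d-6))`, there exist `δ, M, K_IR > 0` such that
`(J_p^{(μ)}, g_p^{(μ)}) ∈ 𝒬_{M,K_IR,ζ}` uniformly in `p ∈ [p_c - δ, p_c)` and `μ ∈ Ω̄_p`." Directly
after it: "We expect Theorem 7.1(ii) to remain valid for all `d > 6`, but our use of the lace
expansion for the nearest-neighbour model requires us to take `d ≥ 15`, in order to apply the
numerical results proved in [FH17]." Theorem 7.1 is a CONSUMER of the Fitzner–van der Hofstad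
bounds at `p_c` (it is not a route to mean-field behaviour below `d = 11`), and it claims nothing for
`d ≤ 14`. Nothing in this file contradicts or weakens anything the paper states.

WHAT THIS FILE RECORDS (statement level).

* §7.2, display `(eq:triangles)`: "We define the tilted triangle diagrams
  `Δ^{(μ)}(p) = ‖τ_p^{(μ)} * τ_p * τ_p - δ_0‖_∞`, `Δ̃^{(μ)}(p) = 2dp ‖P * τ_p^{(μ)} * τ_p * τ_p‖_∞`",
  `P(x) = (2d)⁻¹ 𝟙{‖x‖₁ = 1}` (§7.1), `τ_p^{(μ)}(x) = τ_p(x) e^{μ·x}`. At `μ = 0`, `p = p_c` these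
  are EXACTLY the tree's `percTriBar00 d` (`= sup_x (τ_{p_c}^{⋆3}(x) - δ_{0,x})`, Fitzner–van der
  Hofstad's `T̄^{(0,0)}`) and `percTriTildeBar d` (`= sup_x (τ ⋆ τ ⋆ τ̃)(x)`, `τ̃ = 2dp_c D ⋆ τ`,
  Fitzner–van der Hofstad's `T_{p_c}`): `triangleZeroPc`, `tildeTriangleZeroPc` below are
  abbreviations, not new objects.
* §7.2, display `(eq:triangle^0)` and the sentence after it: "we can take `d₀` sufficiently large
  so that `Δ^{(0)}(p_c) ≤ 0.43`, `Δ̃^{(0)}(p_c) ≤ 0.18` for all `d ≥ d₀`. By the Mathematica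
  notebook of [FH17], `d₀ = 15` is sufficient. In particular, we have
  `Δ̃^{(0)}(p_c)(1 + 2Δ^{(0)}(p_c)) ≤ (0.18)(1.86) = 0.3348`." → `NumericalInput d` (the two
  inequalities), the NAMED FACT `LiuSlade2026_numericalInput` (`∀ d ≥ 15`: a COMPUTER-ASSISTED,
  UNREFEREED claim — an unpublished run of the [FH17] notebook — vendored to be CITED, never proved
  or evaluated here; users take `(h : LiuSlade2026_numericalInput)`), and `haraRate_le_of_numericalInput`
  (the printed product `0.3348`).
* Lemma 7.3 (`d ≥ 11`, `p ≤ p_c`), hypothesis `(eq:perc_r)`: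
  "`e^{‖μ‖_∞} Δ̃^{(μ)}(p)(1 + 2Δ^{(μ)}(p)) ≤ r < 1`", with the remark "Our hypothesis (eq:perc_r) is
  slightly weaker than the original hypothesis `e^{‖μ‖_∞}(p + 2dpΔ^{(μ)}(p))(1 + 2Δ^{(μ)}(p)) ≤ r < 1`
  in [Hara90]; the adequacy of the weaker hypothesis was observed by Hara and is described in
  [FH17]." At `μ = 0`, `p = p_c` the left side is `haraRate (Δ^{(0)}(p_c)) (Δ̃^{(0)}(p_c))`
  `= T_{p_c}(1 + 2T̄^{(0,0)})`, the left side of Fitzner–van der Hofstad's (7.2)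
  ("it suffices to prove that `T_{p_c}(1 + 2T̄^{(0,0)}) < 1`"); `haraRate_lt_one_of_triangleBoundsPc`
  derives (7.2) for every `d ≥ 11` from the tree's named fact (7.1): `0.28036 · 2.07124 = 0.58069… < 1`.
* Lemma 7.6 (`d ≥ 15`: "`Δ^{(μ)}(p) ≤ 2Δ^{(0)}(p_c) + γ`, `Δ̃^{(μ)}(p) ≤ 2Δ̃^{(0)}(p_c) + γ`,
  `B^{(μ)}(p) ≤ B^{(0)}(p_c) + γ`"), proof, display `(eq:perc_boot_pf)`: "Fix `r ∈ [0.98, 1)`. Given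
  the bootstrap hypothesis (and `d ≥ 15`), we can use (eq:triangle^0) to estimate (eq:perc_r) by
  `e^{‖μ‖_∞} Δ̃^{(μ)}(p)(1 + 2Δ^{(μ)}(p)) ≤ e^{‖μ‖_∞}(2Δ̃^{(0)}(p_c) + 2γ)(1 + 4Δ^{(0)}(p_c) + 4γ)`
  `≤ e^{‖μ‖_∞}[2(0.18)(1 + 4(0.43)) + O(γ) + 8γ²] = e^{‖μ‖_∞}[0.9792 + O(γ) + 8γ²]`. Since
  `‖μ‖_∞ ≤ m_p → 0` as `p → p_c`, the above is less than `r` when `γ` and `δ` are sufficiently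
  small." The sentence before the lemma: "Our choice of `δ > 0`, and the need to take `d ≥ 15`
  (rather than `d ≥ 11`), occur in the next lemma." The `γ = 0`, `μ = 0` value of the middle
  expression, `2Δ̃^{(0)}(p_c)(1 + 4Δ^{(0)}(p_c))`, is `closingMajorant` below; the argument closes iff
  it is `< 1` (then `r` is chosen in between). `closingMajorant_le_of_numericalInput` reproduces
  the printed `0.9792`, `closingMajorant_lt_one_of_numericalInput` the conclusion `< 1`.

THE `d = 11` EVALUATION (why the tree's `d ≥ 11` input does not already give `d₀ = 11`; recorded,
not asserted as a theorem about percolation). `FitznerVanDerHofstad2017_triangleBoundsPc` gives, for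
`d ≥ 11`, only the UPPER bounds `Δ^{(0)}(p_c) ≤ 0.53562`, `Δ̃^{(0)}(p_c) ≤ 0.28036`; the best bound
on `closingMajorant` they yield is `2 · 0.28036 · (1 + 4 · 0.53562) = 1.7620513856 > 1` (kernel
arithmetic in the `example`s at the end of the file), so Lemma 7.6's closing step is NOT verified at
`d = 11` from the printed `d = 11` numbers — consistent with the authors' `d ≥ 15`. For comparison,
WITHOUT the two symmetrisation factors `2` of Lemma 7.6 (they enter through
"`Δ^{(μ)}(p) ≤ 2‖τ_sym^{(μ)} * τ_p * τ_p - δ_0‖_∞`" in the proof of Lemma 7.6, where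
"`τ_sym^{(μ)}(x) = ½(τ_p^{(μ)}(x) + τ_p^{(μ)}(-x)) = τ_p(x) cosh(μ·x)`" is defined before Lemma 7.5)
the closing quantity would be the Hara rate itself, bounded by `0.58069… < 1` at `d = 11` — an
observation about the shape of the argument, not a claim that Lemma 7.6 holds at `d = 11`.
Exact rationals: `2 · 0.28036 · (1 + 4 · 0.53562) = 275320529/156250000`; the two printed bounds
would both have to shrink by the factor `λ* = 0.70836…` (root of `8abλ² + 2bλ = 1`,
`(a, b) = (0.53562, 0.28036)`) for the majorant to reach `1`. These are facts about printed
decimals; no declaration of this file evaluates a percolation quantity.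

ABSOLUTE RULE respected: the paper's claims enter only as `def … : Prop` (cited, never asserted);
the theorems below are either monotone arithmetic consequences of those Props or of the tree's
named fact (7.1), with their locators.

## References

* Y. Liu, G. Slade, arXiv:2605.15545v1 (2026): §7.1 (Thm. 7.1 and the paragraph after it;
  `P`, `τ_p`, OZ equation (eq:OZperc)), §7.2 (displays (eq:triangles), (eq:triangle^0) and the two
  sentences after it; Lemma 7.3 with (eq:perc_r) and the [Hara90] remark; Lemma 7.6, its proof
  through (eq:perc_boot_pf), and the sentence preceding the lemma; Cor. 7.7).
* R. Fitzner, R. van der Hofstad, Electron. J. Probab. 22 (2017) no. 43 (arXiv:1506.07977): §7,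
  (7.1)–(7.2) (proof of Thm. 1.4).
* T. Hara, Probab. Theory Related Fields 86 (1990) 337–385 ([Hara90] of the source): the original
  hypothesis quoted in Lemma 7.3's proof.
-/

noncomputable section

namespace Literature.Probability.LiuSlade2026Crossover

open Literature.Barriers.CriticalPhenomena

open scoped ENNReal

variable {d : ℕ}

/-! ### The two untilted critical triangle diagrams of §7.2 are the tree's `T̄^{(0,0)}`, `T_{p_c}` -/

/-- `Δ^{(0)}(p_c) = ‖τ_{p_c} * τ_{p_c} * τ_{p_c} - δ_0‖_∞` (display (eq:triangles) at `μ = 0`,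
`p = p_c`), in `[0, ∞]`: the tree's `percTriBar00 d = sup_x (τ_{p_c}^{⋆3}(x) - δ_{0,x})`
(Fitzner–van der Hofstad's `T̄^{(0,0)}`). An abbreviation.
[cite: LiuSlade2026Crossover, §7.2 display (eq:triangles) (definition of Δ^{(μ)}(p))] -/
abbrev triangleZeroPc (d : ℕ) : ℝ≥0∞ := percTriBar00 d

/-- `Δ̃^{(0)}(p_c) = 2dp_c ‖P * τ_{p_c} * τ_{p_c} * τ_{p_c}‖_∞` (display (eq:triangles) at `μ = 0`,
`p = p_c`), in `[0, ∞]`: the tree's `percTriTildeBar d = sup_x (τ ⋆ τ ⋆ τ̃)(x)`, `τ̃ = 2dp_c D ⋆ τ`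
(Fitzner–van der Hofstad's `T_{p_c}`). An abbreviation.
[cite: LiuSlade2026Crossover, §7.2 display (eq:triangles) (definition of Δ̃^{(μ)}(p))] -/
abbrev tildeTriangleZeroPc (d : ℕ) : ℝ≥0∞ := percTriTildeBar d

/-! ### The numerical input (eq:triangle^0) and the claim "`d₀ = 15` is sufficient" -/

/-- **The numerical input of §7.2 in dimension `d`** (display (eq:triangle^0)):
"`Δ^{(0)}(p_c) ≤ 0.43`, `Δ̃^{(0)}(p_c) ≤ 0.18`".
[cite: LiuSlade2026Crossover, §7.2 display (eq:triangle^0)] -/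
def NumericalInput (d : ℕ) : Prop :=
  triangleZeroPc d ≤ ENNReal.ofReal 0.43 ∧ tildeTriangleZeroPc d ≤ ENNReal.ofReal 0.18

/-- NAMED FACT — **Liu–Slade's computer-assisted claim**: "we can take `d₀` sufficiently large so
that `Δ^{(0)}(p_c) ≤ 0.43`, `Δ̃^{(0)}(p_c) ≤ 0.18` for all `d ≥ d₀`. By the Mathematica notebook of
[FH17], `d₀ = 15` is sufficient." COMPUTER-ASSISTED and UNREFEREED (the authors' evaluation of
the Fitzner–van der Hofstad Mathematica notebook, reported in that one sentence; no table of the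
`d ≥ 15` values is printed): vendored to be CITED as the numerical hypothesis behind Thm. 7.1(ii),
Lemma 7.6 and Cor. 7.7, not as a theorem of this tree; nothing here evaluates it. Users take
`(h : LiuSlade2026_numericalInput)`.
[cite: LiuSlade2026Crossover, §7.2 (sentence after display (eq:triangle^0): "d₀ = 15 is sufficient")] -/
def LiuSlade2026_numericalInput : Prop :=
  ∀ d : ℕ, 15 ≤ d → NumericalInput d

/-! ### The two rates: Lemma 7.3's hypothesis at `μ = 0` and Lemma 7.6's closing majorant -/

/-- **The Hara rate** `Δ̃ (1 + 2Δ)`: the left side of Lemma 7.3's hypothesis (eq:perc_r),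
"`e^{‖μ‖_∞} Δ̃^{(μ)}(p)(1 + 2Δ^{(μ)}(p)) ≤ r < 1`", at `μ = 0`; with `(Δ, Δ̃) = (T̄^{(0,0)}, T_{p_c})`
it is the left side of Fitzner–van der Hofstad's (7.2), `T_{p_c}(1 + 2T̄^{(0,0)}) < 1`.
[cite: LiuSlade2026Crossover, Lemma 7.3 (hypothesis (eq:perc_r))]
[cite: FitznerVanDerHofstad2017, §7 (7.2)] -/
def haraRate (Δ Δt : ℝ≥0∞) : ℝ≥0∞ := Δt * (1 + 2 * Δ)

/-- **Lemma 7.6's closing majorant** `2Δ̃^{(0)}(p_c)(1 + 4Δ^{(0)}(p_c))`: the `γ = 0`, `μ = 0` value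
of "`(2Δ̃^{(0)}(p_c) + 2γ)(1 + 4Δ^{(0)}(p_c) + 4γ)`" in display (eq:perc_boot_pf) — the bound on
Lemma 7.3's rate available under Lemma 7.6's bootstrap hypotheses `Δ^{(μ)}(p) ≤ 2Δ^{(0)}(p_c) + 2γ`,
`Δ̃^{(μ)}(p) ≤ 2Δ̃^{(0)}(p_c) + 2γ`; the proof closes iff this is `< 1` ("the above is less than `r`
when `γ` and `δ` are sufficiently small", `r ∈ [0.98, 1)`).
[cite: LiuSlade2026Crossover, Lemma 7.6 (proof, display (eq:perc_boot_pf))] -/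
def closingMajorant (Δ Δt : ℝ≥0∞) : ℝ≥0∞ := 2 * Δt * (1 + 4 * Δ)

/-- `haraRate` is monotone in both diagrams. [folklore] -/
private theorem haraRate_mono {Δ Δ' Δt Δt' : ℝ≥0∞} (h₁ : Δ ≤ Δ') (h₂ : Δt ≤ Δt') :
    haraRate Δ Δt ≤ haraRate Δ' Δt' := by
  unfold haraRate
  gcongr

/-- `closingMajorant` is monotone in both diagrams. [folklore] -/
private theorem closingMajorant_mono {Δ Δ' Δt Δt' : ℝ≥0∞} (h₁ : Δ ≤ Δ') (h₂ : Δt ≤ Δt') :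
    closingMajorant Δ Δt ≤ closingMajorant Δ' Δt' := by
  unfold closingMajorant
  gcongr

/-- Real-number evaluation of `haraRate` at `ofReal` arguments. [folklore] -/
private theorem haraRate_ofReal {a b : ℝ} (ha : 0 ≤ a) (hb : 0 ≤ b) :
    haraRate (ENNReal.ofReal a) (ENNReal.ofReal b) = ENNReal.ofReal (b * (1 + 2 * a)) := by
  unfold haraRate
  rw [ENNReal.ofReal_mul hb, ENNReal.ofReal_add zero_le_one (by positivity),
    ENNReal.ofReal_one, ENNReal.ofReal_mul zero_le_two, ENNReal.ofReal_ofNat]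

/-- Real-number evaluation of `closingMajorant` at `ofReal` arguments. [folklore] -/
private theorem closingMajorant_ofReal {a b : ℝ} (ha : 0 ≤ a) (hb : 0 ≤ b) :
    closingMajorant (ENNReal.ofReal a) (ENNReal.ofReal b) =
      ENNReal.ofReal (2 * b * (1 + 4 * a)) := by
  unfold closingMajorant
  rw [ENNReal.ofReal_mul (by positivity), ENNReal.ofReal_mul zero_le_two, ENNReal.ofReal_ofNat,
    ENNReal.ofReal_add zero_le_one (by positivity), ENNReal.ofReal_one,
    ENNReal.ofReal_mul (by norm_num : (0 : ℝ) ≤ 4), ENNReal.ofReal_ofNat]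

/-! ### The printed arithmetic of §7.2, reproduced -/

/-- **"`Δ̃^{(0)}(p_c)(1 + 2Δ^{(0)}(p_c)) ≤ (0.18)(1.86) = 0.3348`"** under (eq:triangle^0).
[cite: LiuSlade2026Crossover, §7.2 (display after (eq:triangle^0): (0.18)(1.86) = 0.3348)] -/
theorem haraRate_le_of_numericalInput (h : NumericalInput d) :
    haraRate (triangleZeroPc d) (tildeTriangleZeroPc d) ≤ ENNReal.ofReal 0.3348 :=
  calc haraRate (triangleZeroPc d) (tildeTriangleZeroPc d)
      ≤ haraRate (ENNReal.ofReal 0.43) (ENNReal.ofReal 0.18) := haraRate_mono h.1 h.2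
    _ = ENNReal.ofReal (0.18 * (1 + 2 * 0.43)) := haraRate_ofReal (by norm_num) (by norm_num)
    _ = ENNReal.ofReal 0.3348 := by norm_num

/-- **"`2(0.18)(1 + 4(0.43)) = 0.9792`"**: under (eq:triangle^0) Lemma 7.6's closing majorant is
at most `0.9792`. [cite: LiuSlade2026Crossover, Lemma 7.6 (proof, display (eq:perc_boot_pf): 0.9792)] -/
theorem closingMajorant_le_of_numericalInput (h : NumericalInput d) :
    closingMajorant (triangleZeroPc d) (tildeTriangleZeroPc d) ≤ ENNReal.ofReal 0.9792 :=
  calc closingMajorant (triangleZeroPc d) (tildeTriangleZeroPc d)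
      ≤ closingMajorant (ENNReal.ofReal 0.43) (ENNReal.ofReal 0.18) := closingMajorant_mono h.1 h.2
    _ = ENNReal.ofReal (2 * 0.18 * (1 + 4 * 0.43)) :=
        closingMajorant_ofReal (by norm_num) (by norm_num)
    _ = ENNReal.ofReal 0.9792 := by norm_num

/-- **The bootstrap of Lemma 7.6 closes under (eq:triangle^0)**: the closing majorant is `< 1`
(so an `r ∈ [0.98, 1)` above it exists, as the proof requires).
[cite: LiuSlade2026Crossover, Lemma 7.6 (proof: "the above is less than r when γ and δ are sufficiently small")] -/
theorem closingMajorant_lt_one_of_numericalInput (h : NumericalInput d) :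
    closingMajorant (triangleZeroPc d) (tildeTriangleZeroPc d) < 1 :=
  lt_of_le_of_lt (closingMajorant_le_of_numericalInput h) <| by
    rw [← ENNReal.ofReal_one]
    exact (ENNReal.ofReal_lt_ofReal_iff zero_lt_one).2 (by norm_num)

/-- For `d ≥ 15`, granted the named fact: Lemma 7.6's closing majorant is `< 1` and Lemma 7.3's
`μ = 0` rate is `≤ 0.3348`. [cite: LiuSlade2026Crossover, §7.2 (eq:triangle^0), Lemma 7.6, Cor. 7.7 (d ≥ 15)] -/
theorem closes_of_numericalInput (h : LiuSlade2026_numericalInput) (hd : 15 ≤ d) :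
    closingMajorant (triangleZeroPc d) (tildeTriangleZeroPc d) < 1 ∧
      haraRate (triangleZeroPc d) (tildeTriangleZeroPc d) ≤ ENNReal.ofReal 0.3348 :=
  ⟨closingMajorant_lt_one_of_numericalInput (h d hd), haraRate_le_of_numericalInput (h d hd)⟩

/-! ### Fitzner–van der Hofstad's (7.2) from (7.1): the `μ = 0` rate for every `d ≥ 11` -/

/-- **Fitzner–van der Hofstad (7.2) from (7.1)**: for `d ≥ 11`,
`T_{p_c}(1 + 2T̄^{(0,0)}) ≤ 0.28036 · (1 + 2 · 0.53562) = 0.5806928464` ("The bound in (7.2)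
follows from (7.1)"); equivalently Lemma 7.3's hypothesis (eq:perc_r) at `μ = 0`, `p = p_c` holds
with any `r ∈ (0.5807, 1)`.
[cite: FitznerVanDerHofstad2017, §7 (7.1)–(7.2) (proof of Thm. 1.4)]
[cite: LiuSlade2026Crossover, Lemma 7.3 (hypothesis (eq:perc_r), d ≥ 11)] -/
theorem haraRate_le_of_triangleBoundsPc (h : FitznerVanDerHofstad2017_triangleBoundsPc)
    (hd : 11 ≤ d) :
    haraRate (triangleZeroPc d) (tildeTriangleZeroPc d) ≤ ENNReal.ofReal 0.5806928464 :=
  calc haraRate (triangleZeroPc d) (tildeTriangleZeroPc d)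
      ≤ haraRate (ENNReal.ofReal 0.53562) (ENNReal.ofReal 0.28036) :=
        haraRate_mono (h.percTriBar00_le hd) (h.percTriTildeBar_le hd)
    _ = ENNReal.ofReal (0.28036 * (1 + 2 * 0.53562)) := haraRate_ofReal (by norm_num) (by norm_num)
    _ = ENNReal.ofReal 0.5806928464 := by norm_num

/-- **(7.2) holds for every `d ≥ 11`**: `T_{p_c}(1 + 2T̄^{(0,0)}) < 1`.
[cite: FitznerVanDerHofstad2017, §7 (7.2) ("it suffices to prove that T_{p_c}(1+2T̄^{(0,0)}) < 1 … The bound in (7.2) follows from (7.1)")] -/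
theorem haraRate_lt_one_of_triangleBoundsPc (h : FitznerVanDerHofstad2017_triangleBoundsPc)
    (hd : 11 ≤ d) : haraRate (triangleZeroPc d) (tildeTriangleZeroPc d) < 1 :=
  lt_of_le_of_lt (haraRate_le_of_triangleBoundsPc h hd) <| by
    rw [← ENNReal.ofReal_one]
    exact (ENNReal.ofReal_lt_ofReal_iff zero_lt_one).2 (by norm_num)

/-- **What (7.1) gives for Lemma 7.6's closing majorant at `d ≥ 11`**: only
`≤ 2 · 0.28036 · (1 + 4 · 0.53562) = 1.7620513856` — which is NOT `< 1` (see the `example`s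
below), so the `d = 11` numbers of [FH17] do not verify Lemma 7.6's closing step; the authors take
`d ≥ 15`. (Upper bounds only: this does not say the step fails at `d = 11`.)
[cite: FitznerVanDerHofstad2017, §7 (7.1)]
[cite: LiuSlade2026Crossover, Lemma 7.6 (proof, (eq:perc_boot_pf)) and the sentence before Lemma 7.6 ("the need to take d ≥ 15 (rather than d ≥ 11)")] -/
theorem closingMajorant_le_of_triangleBoundsPc (h : FitznerVanDerHofstad2017_triangleBoundsPc)
    (hd : 11 ≤ d) :
    closingMajorant (triangleZeroPc d) (tildeTriangleZeroPc d) ≤ ENNReal.ofReal 1.7620513856 :=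
  calc closingMajorant (triangleZeroPc d) (tildeTriangleZeroPc d)
      ≤ closingMajorant (ENNReal.ofReal 0.53562) (ENNReal.ofReal 0.28036) :=
        closingMajorant_mono (h.percTriBar00_le hd) (h.percTriTildeBar_le hd)
    _ = ENNReal.ofReal (2 * 0.28036 * (1 + 4 * 0.53562)) :=
        closingMajorant_ofReal (by norm_num) (by norm_num)
    _ = ENNReal.ofReal 1.7620513856 := by norm_num

/-! ### Kernel arithmetic for the `d = 11` evaluation (checked, not named) -/

/-- The majorant of Lemma 7.6 at the [FH17] `d = 11` pair exceeds `1`: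
`2 · 0.28036 · (1 + 4 · 0.53562) = 1.7620513856 = 275320529/156250000`. -/
example : (2 : ℝ) * 0.28036 * (1 + 4 * 0.53562) = 1.7620513856 := by norm_num
example : (2 : ℚ) * 0.28036 * (1 + 4 * 0.53562) = 275320529 / 156250000 := by norm_num
example : (1 : ℝ) < 2 * 0.28036 * (1 + 4 * 0.53562) := by norm_num
/-- The Hara rate (7.2) at the same pair: `0.28036 · 2.07124 = 0.5806928464 < 1`. -/
example : (0.28036 : ℝ) * (1 + 2 * 0.53562) = 0.5806928464 := by norm_num
/-- The printed Liu–Slade products: `2(0.18)(1.72 + 1) … = 0.9792`, `(0.18)(1.86) = 0.3348`. -/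
example : (2 : ℝ) * 0.18 * (1 + 4 * 0.43) = 0.9792 := by norm_num
example : (0.18 : ℝ) * (1 + 2 * 0.43) = 0.3348 := by norm_num
/-- Uniform shrink factor: at `λ = 0.708365152636` the scaled majorant is still `< 1`, at
`λ = 0.708365152637` it exceeds `1` (so `λ* = 0.70836515263…`). -/
example : (2 : ℝ) * (0.708365152636 * 0.28036) * (1 + 4 * (0.708365152636 * 0.53562)) < 1 := by
  norm_num
example : (1 : ℝ) < 2 * (0.708365152637 * 0.28036) * (1 + 4 * (0.708365152637 * 0.53562)) := by
  norm_num

end Literature.Probability.LiuSlade2026Crossover
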